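import Summits.QuantumFields.YangMills.Theorems.TwistedTraceScaling.Negative.CentralGaussianRadiusWindow
import HarnessLib

/-!
# Negative lemma R46b (cdisprove g38) — the radius window of the RELATIVE-LOCAL central Gaussian comparison
# (crux `TwistedTraceScaling` stmt-QuantumFields-20203, skeleton «twolattice»; vets `…BOCentralTube` §4 = p686369:
# `central_gaussian_tube_lower_local`, `central_transfer_two_sided_of_localisedAvg_local`)

The relative-local (C1) glue assumes the lower Gaussian comparison `hAlo` only on chart points `w` of the polydisc with
`‖chartVec w − linkEmbed v′‖ ≤ R₀` around the tube coordinate of the centre `v′` (`‖linkEmbed v′‖ ≤ R`, `6T²R ≤ R₀`), with tail radius `min(ρ − 2T, R₀ − 6T²R)`.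
This file transports the three findings of `…Negative.CentralGaussianRadiusWindow` (R46) to that form:

* `central_gaussian_tube_lower_local_nonpos` ★★: the lower constant is `≤ 0` — VACUOUS — unless `min(ρ−2T, R₀−6T²R)²β > 9L³·log 2 + 98βR²`; in particular `R₀ > √98·R`
  and `R₀ > 3L^{3/2}√(log 2)·β^{-1/2}` (volume-dependent Laplace radius: a threshold for S-BASE at fixed `L`, not a kill).
* `not_hAloAt_of_sq_lt` / `not_hAloLocal_of_sq_lt` ★★★: under the glue's support hypotheses (ONE scale `T` for the components of `supp Ω` and the gauge closeness of `supp W`,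
  `8T ≤ ρ ≤ 1/2`) and any pointwise comparison `mc·G ≤ A_W(χ₀⊗Ω)`, `mc > 0` (for `G := A`: `mc = 1`, `not_hAloLocal_glue`), the relative-local lower hypothesis around a centre
  `x′` with `‖x′‖ ≤ R′` is FALSE for every `gm > 0` once `(R₀ − R′)² > (200/3)T²` (`R′ ≤ R₀`): the local ball then contains the two-link zeros of `A` (R45/R46).
* `window_local` ★★: `hAlo` (⇒ `(R₀−R)² ≤ (200/3)T²`) and an informative lower constant (⇒ `min(ρ−2T, R₀−6T²R)²β > 9L³log 2 + 98βR²`) force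
  `98R² < R₀² < 85T²` (so `R < 0.93·T`) and `9L³·log 2 < 85·T²·β` (`T > 0.27·L^{3/2}·β^{-1/2}`).
READING (constraints on the unbuilt brick (C1c′); nothing landed is wrong): with one support scale `T` the relative-local window is open only when the fibre-norm radius `R` of `supp Ω`
is below the component/gauge scale `T` and `T ≳ L^{3/2}β^{-1/2}`; in the record instance the gauge scale (`≈ 7.5Lβ^{-1/2}ℓ²`, `coreWeight`) is much larger than the profile radius
(`β^{-1/2}ℓ`), so the window `9.9R ≲ R₀ ≲ 8.2T` is open there — but NOT on the schedule `T, R = O(β^{-1/2}ℓ)` announced in the `…BOCentralTube` docstring, and on paper the transverse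
zeros of `A` sit already at `≈ r_supp(1+o(1))` whatever `T₂` is (Disproof.lean (ab)).  HONEST FRAMING: negative/boundary lemmas (helper, `--supports stmt-QuantumFields-20203`) about
hypotheses of bricks of a stub of a child of the CONDITIONAL reduction route R2b1; nothing here refutes or proves `TwistedTraceScaling`, S-BASE, (B-OD) or C4-CORE; not infinite
volume, not a gap, not Clay. bears_on R2b1.
-/

set_option autoImplicit false

noncomputable section

open MeasureTheory Filter Topology Real
open scoped BigOperators RealInnerProductSpace
open Literature.MathematicalPhysics.QuantumFieldTheory hiding SU2
open Literature.MathematicalPhysics.QuantumLattice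

namespace Summit.QuantumFields.YangMills.Theorems.TwistedTraceScaling.Negative.R46L

open Summit.QuantumFields.YangMills.Theorems.FemtoTransferGap
open Summit.QuantumFields.YangMills.Theorems.FemtoTransferGap.TwoLattice
open Summit.QuantumFields.YangMills.Theorems.FemtoTransferGap.TwoLattice.Avg
open Summit.QuantumFields.YangMills.Theorems.FemtoTransferGap.TwoLattice.ConstTube
open Summit.QuantumFields.YangMills.Theorems.FemtoTransferGap.TwoLattice.Stiff
open Summit.QuantumFields.YangMills.Theorems.FemtoTransferGap.TwoLattice.GnChart
open Summit.QuantumFields.YangMills.Theorems.TwistedTraceScaling.Negative.R45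
open Summit.QuantumFields.YangMills.Theorems.TwistedTraceScaling.Negative.R46

variable {L : ℕ} [NeZero L]

/-! ## §1 Vacuity radius of the relative-local lower constant -/

/-- ★★ **The lower constant of `…BOCentralTube.central_gaussian_tube_lower_local` / `central_transfer_two_sided_of_localisedAvg_local` is `≤ 0` unless
`min(ρ − 2T, R₀ − 6T²R)²·β > 9L³·log 2 + 98βR²`** (so `R₀ − 6T²R > √98·R` and `> 3L^{3/2}√(log 2)·β^{-1/2}`). [folklore] -/
theorem central_gaussian_tube_lower_local_nonpos {β : ℝ} (hβ : 0 < β) {ρ T R R₀ : ℝ}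
    (hm : (min (ρ - 2 * T) (R₀ - 6 * T ^ 2 * R)) ^ 2 * β ≤ Fintype.card (Edge 3 L × Fin 3) * Real.log 2 + 98 * β * R ^ 2) {gm : ℝ} (hgm : 0 ≤ gm)
    (x' : LinkSpace L) :
    Real.exp (2 * β) ^ Fintype.card (Edge 3 L) * ((2 * π ^ 2)⁻¹ * ((1 + ρ ^ 2)⁻¹) ^ 2) ^ Fintype.card (Edge 3 L) *
          Real.exp (-(2000 * Fintype.card (Plaquette 3 L) * ρ ^ 3 * β)) * gm *
        (Real.exp (-(882 * β * T ^ 2 * R ^ 2)) -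
          Real.exp (49 * β * R ^ 2) * (Real.exp (-(β * (min (ρ - 2 * T) (R₀ - 6 * T ^ 2 * R)) ^ 2 / 2)) * (π / (β / 2)) ^ ((Module.finrank ℝ (LinkSpace L) : ℝ) / 2)) /
            stiffGaussTop L (β / 2) β) *
        (stiffGaussTop L (β / 2) β * Real.exp (-stiffGaussExp L (β / 2) β x')) ≤ 0 := by
  have ht : (0 : ℝ) ≤ β / 2 := by positivity
  have hS := stiffGaussTop_pos (L := L) ht hβ
  have h := top_mul_exp_le_tail (L := L) ht hβ (m := min (ρ - 2 * T) (R₀ - 6 * T ^ 2 * R)) (c := 49 * β * R ^ 2) (by linarith) (0 : LinkSpace L)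
  rw [stiffGaussExp_zero, neg_zero, Real.exp_zero, mul_one] at h
  refine mul_nonpos_of_nonpos_of_nonneg (mul_nonpos_of_nonneg_of_nonpos (by positivity) (sub_nonpos.2 ?_)) (by positivity)
  rw [le_div_iff₀ hS]
  calc Real.exp (-(882 * β * T ^ 2 * R ^ 2)) * stiffGaussTop L (β / 2) β ≤ 1 * stiffGaussTop L (β / 2) β :=
        mul_le_mul_of_nonneg_right (Real.exp_le_one_iff.2 (neg_nonpos.2 (by positivity))) hS.le
    _ ≤ _ := by rw [one_mul]; exact h

/-! ## §2 ★★★ The relative-local lower Gaussian hypothesis is false beyond the two-link radius -/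

/-- ★★★ **Shifted ball.**  Under the support hypotheses of the (C1) glue (one scale `T ≥ 0`), `0 < ρ ≤ 1/2`, `8T ≤ ρ`, and a comparison `mc·G ≤ A_W(χ₀⊗Ω)` with `mc > 0`: for any
centre `x′` with `‖x′‖ ≤ R′ ≤ R₀` and `(R₀ − R′)² > (200/3)T²`, NO `gm > 0` satisfies `gm·e^{−q(chartVec w)} ≤ G(P w)` on `{∀ e, Σ_a w_e a² ≤ ρ²} ∩ {‖chartVec w − x′‖ ≤ R₀}`
(the ball contains the centred ball of radius `R₀ − R′`, hence the two-link zeros of `A`, `R46.not_hAlo_of_sq_lt`). [folklore] -/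
theorem not_hAloAt_of_sq_lt {Ω : LinkSpace L → ℝ} {W : (Site 3 L → SU2) → ℝ} {T : ℝ} (hT0 : 0 ≤ T)
    (hΩt : ∀ v : Edge 3 L → Fin 3 → ℝ, Ω (linkEmbed L v) ≠ 0 → ∀ e c, |v e c| ≤ T)
    (hWc : ∀ g : Site 3 L → SU2, W g ≠ 0 → ∀ x, ‖su2Quat (g x) - 1‖ ≤ T)
    (χ₀ : GaugeConfig 3 1 SU2 → ℝ) {x₁ x₂ : Site 3 L} (hx : x₁ ≠ x₂) (k : Fin 3)
    {ρ R' R₀ : ℝ} (hρ : 0 < ρ) (hρ2 : ρ ≤ 1 / 2) (hTρ : 8 * T ≤ ρ) {x' : LinkSpace L} (hx' : ‖x'‖ ≤ R') (hR' : R' ≤ R₀) (hR₀T : 200 / 3 * T ^ 2 < (R₀ - R') ^ 2)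
    {G : GaugeConfig 3 L SU2 → ℝ} {mc : ℝ} (hmc : 0 < mc)
    (hC1c : ∀ V, mc * G V ≤ ∫ g, W g * boFun L χ₀ Ω (gaugeTransform g⁻¹ V) ∂gaugeMeasure L) {β gm : ℝ} (hgm : 0 < gm) :
    ¬ ∀ w : Edge 3 L → Fin 3 → ℝ, (∀ e, ∑ c, w e c ^ 2 ≤ ρ ^ 2) → ‖chartVec w - x'‖ ≤ R₀ →
        gm * Real.exp (-stiffGaussExp L (β / 2) β (chartVec w)) ≤ G (latPatternChart L (fun _ => false) w) := fun h =>
  not_hAlo_of_sq_lt hT0 hΩt hWc χ₀ hx k hρ hρ2 hTρ (R₁ := R₀ - R') (sub_nonneg.2 hR') hR₀T hmc hC1c hgm fun w hw hn =>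
    h w hw (((norm_sub_le _ _).trans (add_le_add hn hx')).trans (by linarith))

/-- ★★★ **In the parameters of `…BOCentralTube.central_transfer_two_sided_of_localisedAvg_local`** (bundled support hypotheses `hΩt`, `hWc` of the glue with one scale `T`;
centre `v′` with `‖linkEmbed v′‖ ≤ R`; `0 < ρ ≤ 1/2`, `8T ≤ ρ`; `G := A_W(χ₀⊗Ω)` itself): its hypothesis `hAlo` is FALSE for every `gm > 0` as soon as `R ≤ R₀` and
`(R₀ − R)² > (200/3)·T²` (`R₀ > R + 8.165·T`), provided the lattice has two distinct sites. [folklore] -/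
theorem not_hAloLocal_glue {Ω : LinkSpace L → ℝ} {W : (Site 3 L → SU2) → ℝ} {T R Γ : ℝ} (hT0 : 0 ≤ T)
    (hΩt : ∀ v : Edge 3 L → Fin 3 → ℝ, Ω (linkEmbed L v) ≠ 0 → v ∈ capBalancedSet L ∧ (∀ (e : Edge 3 L) (c : Fin 3), |v e c| ≤ T) ∧ ‖linkEmbed L v‖ ≤ R)
    (hWc : ∀ g : Site 3 L → SU2, W g ≠ 0 → (∀ x, ‖su2Quat (g x) - 1‖ ≤ T) ∧ ‖∑ x, vecPart (g x)‖ ≤ Γ)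
    (χ₀ : GaugeConfig 3 1 SU2 → ℝ) {x₁ x₂ : Site 3 L} (hx : x₁ ≠ x₂) (k : Fin 3)
    {v' : Edge 3 L → Fin 3 → ℝ} (hx' : ‖linkEmbed L v'‖ ≤ R)
    {ρ R₀ : ℝ} (hρ : 0 < ρ) (hρ2 : ρ ≤ 1 / 2) (hTρ : 8 * T ≤ ρ) (hRR₀ : R ≤ R₀) (hR₀T : 200 / 3 * T ^ 2 < (R₀ - R) ^ 2) {β gm : ℝ} (hgm : 0 < gm) :
    ¬ ∀ w : Edge 3 L → Fin 3 → ℝ, (∀ e, ∑ a, w e a ^ 2 ≤ ρ ^ 2) → ‖chartVec w - linkEmbed L v'‖ ≤ R₀ →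
        gm * Real.exp (-stiffGaussExp L (β / 2) β (chartVec w)) ≤
          ∫ g, W g * boFun L χ₀ Ω (gaugeTransform g⁻¹ (latPatternChart L (fun _ => false) w)) ∂gaugeMeasure L :=
  not_hAloAt_of_sq_lt hT0 (fun v hv => (hΩt v hv).2.1) (fun g hg => (hWc g hg).1) χ₀ hx k hρ hρ2 hTρ hx' hRR₀ hR₀T one_pos
    (fun _ => (one_mul _).le) hgm

/-! ## §3 ★★ The window left for the relative-local (C1) glue with `G := A_W(χ₀⊗Ω)` -/

/-- ★★ **Window, relative-local form.**  In the parameters of `…central_transfer_two_sided_of_localisedAvg_local` (`β > 0`, `0 ≤ T`, `0 ≤ R`, `6T²R ≤ R₀`): if `hAlo` holds with some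
`gm > 0` — so `(R₀ − R)² ≤ (200/3)T²` by `not_hAloLocal_glue` — and the lower constant is informative — so `min(ρ−2T, R₀−6T²R)²β > |E×3|·log 2 + 98βR²` by
`central_gaussian_tube_lower_local_nonpos` — then `98R² < R₀²`, `R₀² < 85T²` (hence `R < 0.93·T`) and `9L³·log 2 < 85·T²·β` (`T > 0.27·L^{3/2}·β^{-1/2}`). [folklore] -/
theorem window_local {β T R R₀ ρ : ℝ} (hβ : 0 < β) (hT0 : 0 ≤ T) (hTρ : 8 * T ≤ ρ) (hR0 : 0 ≤ R) (hR₀ : 6 * T ^ 2 * R ≤ R₀)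
    (hinfo : Fintype.card (Edge 3 L × Fin 3) * Real.log 2 + 98 * β * R ^ 2 < (min (ρ - 2 * T) (R₀ - 6 * T ^ 2 * R)) ^ 2 * β)
    (hAlo : (R₀ - R) ^ 2 ≤ 200 / 3 * T ^ 2) :
    98 * R ^ 2 < R₀ ^ 2 ∧ R₀ ^ 2 < 85 * T ^ 2 ∧ 9 * (L : ℝ) ^ 3 * Real.log 2 < 85 * T ^ 2 * β := by
  have hc0 : 0 ≤ (Fintype.card (Edge 3 L × Fin 3) : ℝ) * Real.log 2 := mul_nonneg (Nat.cast_nonneg _) (Real.log_nonneg one_le_two)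
  have h6 : 0 ≤ 6 * T ^ 2 * R := by positivity
  have h1 : 0 ≤ ρ - 2 * T := by linarith
  have h2 : 0 ≤ R₀ - 6 * T ^ 2 * R := by linarith
  have hR₀0 : 0 ≤ R₀ := by linarith
  have hmin : (min (ρ - 2 * T) (R₀ - 6 * T ^ 2 * R)) ^ 2 ≤ (R₀ - 6 * T ^ 2 * R) ^ 2 := pow_le_pow_left₀ (le_min h1 h2) (min_le_right _ _) 2
  have hA : Fintype.card (Edge 3 L × Fin 3) * Real.log 2 + 98 * β * R ^ 2 < (R₀ - 6 * T ^ 2 * R) ^ 2 * β :=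
    hinfo.trans_le (mul_le_mul_of_nonneg_right hmin hβ.le)
  have hB : (R₀ - 6 * T ^ 2 * R) ^ 2 ≤ R₀ ^ 2 := by nlinarith [mul_nonneg h6 h2, mul_nonneg h6 hR₀0]
  have hBβ := mul_le_mul_of_nonneg_right hB hβ.le
  have h98 : 98 * R ^ 2 < R₀ ^ 2 := by
    by_contra h
    push Not at h
    have := mul_le_mul_of_nonneg_right h hβ.le
    nlinarith
  have h9 : 9 * R < R₀ := (abs_lt.1 (abs_lt_of_sq_lt_sq (by nlinarith [sq_nonneg R]) hR₀0)).2
  have hR₀pos : 0 < R₀ := by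
    rcases eq_or_lt_of_le h2 with h | h
    · exfalso
      rw [← h] at hA
      have : (0 : ℝ) ≤ 98 * β * R ^ 2 := by positivity
      nlinarith
    · linarith
  have hC : R₀ ^ 2 < 85 * T ^ 2 := by
    nlinarith [mul_pos (sub_pos.2 h9) (by linarith : (0 : ℝ) < 17 * R₀ - 9 * R)]
  refine ⟨h98, hC, ?_⟩
  rw [← card_mul_log_two (L := L)]
  have h5 : 0 ≤ 98 * β * R ^ 2 := by positivity
  have hCβ := mul_lt_mul_of_pos_right hC hβ
  linarith

end Summit.QuantumFields.YangMills.Theorems.TwistedTraceScaling.Negative.R46L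

end
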